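import Mathlib
import HarnessLib
import HarnessLib.Audit
import Summits.Langlands.Statement
import HarnessLib.Audit.Check
import Literature.NumberTheory.GaloisRepresentations.SymplecticMultiplier
import Literature.NumberTheory.GaloisRepresentations.WeightTwoOrdinaryDistinguished
import HarnessLib.Audit.Status.Attr

/-!
Route: RepeatedRootSocle

DORMANT since 2026-08-24T09:49:19Z (reconciler: no traction for 6.7 d (last activity item-evidence-added at 2026-08-17T16:56:34Z); parked, not closed — `ledger route dormant route-Langlands-RepeatedRootSocle --off` to reactivate) — unstaffed, not closed; items shared with open routes are served there. `ledger route dormant <id> --off` reactivates.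

# Route RepeatedRootSocle — repeated Frobenius roots for ordinary abelian surfaces via the socle of
the weight-(2,2) Hecke fibre

It suffices to show X = UnrefinedWeightTwoLiftingR: the weight-2 P-ordinary automorphy lifting
theorem of Boxer–Calegari–Gee–Pilloni for irreducible symplectic ρ : Γ_ℚ → GL₄(ℚ̄_p) in the
HOMOLOGICAL convention ρ ≈ V_p(A) (p odd; multiplier the cyclotomic character ε; at p the
Siegel-parabolic ordinary shape (εα, εβ | β⁻¹, α⁻¹) with unramified α, β and diagonal diagonal
blocks; pure of weight 1 a.e. with ℤ-integral ARITHMETIC-Frobenius polynomial; residually enormous;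
congruent a.e. to an automorphic ρ₀ of the same shape) WITHOUT the clause "α ≠ β" (repeated unit
Frobenius roots allowed: BCGP 2025 Thm 1.1 condition (3) "the characteristic polynomial of Frobenius
at 3 does not have repeated roots" dropped). X is reached in two steps that never use a Borel
refinement at the repeated-root point: PadicLimitUnrefinedR (ρ is a p-adic limit of automorphic
representations — a char-0 point of the ordinary higher-Hida family) and LimitClassicalUnrefinedR
(such a limit is automorphic — classicality at a possibly NON-REDUCED weight-(2,2) Hecke fibre by
the socle argument). Operator B transfer (DICTIONARY.md): the solved sibling is GL₂/ℚ weight one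
with coincident eigenvalues (Calegari–Geraghty Cor. 1.4; Pan Thm 1.0.3), where the U_p-eigenline is
the socle of a Jordan block and q-expansion multiplicity one survives α = β; the BREAKS row is
multiplicity one for Siegel eigenforms, repaired by fibre cyclicity.
REPAIR 2026-08-17 (gen-3 route-repair): the rev-≤4 decls UnrefinedWeightTwoLifting /
LimitClassicalUnrefined / PadicLimitUnrefined typed the multiplier as ε⁻¹ (BCGP's COHOMOLOGICAL
convention H¹) while inlining the HOMOLOGICAL P-ordinary shape and a ℤ-integral arithmetic-Frobenius
polynomial; `Theorems/SectorComplement/Negative/RepeatedRootSocleVacuity.lean` (refuter,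
kernel-checked) shows that hypothesis set is unsatisfiable (det² = ε⁻⁴ against P(0) ∈ ℤ at any v ∤
p), so those three statements hold ex falso and the old junction SectorComplement ↔ Langlands. They
stay in the file as settled negative knowledge (re-badged aside); the live items are the R-suffixed
repairs with multiplier ε (det = ε², consistent with the shape —
`IsWeightTwoOrdinaryDistinguished.coe_det_apply` — and with P(0) = q² of a Weil polynomial), exactly
PhantomRM's convention.
Lean: `UnrefinedWeightTwoLiftingR` (decl of this route; elaborated in Sketch.lean with the new
deciding theorem, lean check rc 0, 0 sorries; BC7 probes CLEAN 4/4)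

## Assembly
Pure logic (glue.lean, sorry-free): PadicLimitUnrefinedR supplies the p-adic-limit hypothesis `Lim
ρ` of LimitClassicalUnrefinedR for the ρ of the target, giving UnrefinedWeightTwoLiftingR;
SectorComplementR carries it to `Langlands`. Deciding theorem `closes : PadicLimitUnrefinedR →
LimitClassicalUnrefinedR → SectorComplementR → Langlands` — binders = the three live cruxes, every
one consumed (native audit: binder_used 3/3, unused [], codes []). The legacy frame item `Assembly`
(over the rev-≤4 decls; gate-locked, cannot be dropped or re-badged) is provable outright by two
modus ponens and is DERIVED INLINE inside `closes` (so it stays in the cone; hand-off proof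
AssemblyProof.lean on stmt-Langlands-18090 still applies verbatim).

Rationale: WHY THIS LINE. BoxerCalegariGeePilloni2025 (arXiv:2502.20645) prove modularity of abelian surfaces/ℚ
ordinary at 3 by a Pan-style classicality theorem (Thm 277, `multiplicity-one-implies-classical`:
the arithmetic Sen operator on the ordinary 𝔟-cohomology V induces the Cousin map whose kernel is
the classical part); their only use of "no repeated roots at 3" is multiplicity one, obtained from
Diamond's freeness criterion (doi:10.1007/s002220050189) through REGULARITY of the Borel-ordinary
local deformation ring, which fails at a repeated-root point (§7 p.104; Lemma 324: the fibre of
flags is a P¹). The line imports the mechanism of the solved GL₂ weight-one case with α = β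
(CalegariGeraghty2017 Cor. 1.4, arXiv:1207.4224; Pan2022LocallyAnalytic Thm 1.0.3, arXiv:2008.07099;
Calegari arXiv:2109.14145 fn. 14): do not refine — at a repeated-root point two Hida families cross
(or one ramifies) and the weight-(2,2) Hecke fibre A = T_x/P is a length-2 Gorenstein Artin algebra;
the 𝔪_f-EIGENline is the socle y·M̄ of each fibre; the Cousin map is A-linear and vanishes modulo y
because ρ is de Rham on the COINVARIANTS V/𝔪_fV (BCGP Rem. 279), hence c(ym) = y·c(m) ∈ y²M̄ = 0:
the eigenform is classical with multiplicity one replaced by cyclicity of the fibre. Imported areas: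
commutative algebra of Artinian Gorenstein fibres (socle/coinvariant duality), geometric Sen theory
(taken from BCGP as a black box), higher Hida theory. No route of this summit touches the
non-p-distinguished ordinary case (AbelianSurfaceSerre, RegularSerreAbelianSurfaces,
PhantomRMYoshida all assume BCGP's p-distinguished engine; the tree's
`IsWeightTwoOrdinaryDistinguishedAt` vendors the clause ᾱ ≠ β̄). CONVENTION (repair 2026-08-17): all
live items are typed in the HOMOLOGICAL convention ρ ≈ V_p(A) — multiplier ε, P-ordinary shape (εα,
εβ | β⁻¹, α⁻¹) as in `Literature.NumberTheory.GaloisRepresentations.WeightTwoOrdinaryDistinguished`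
(det = ε², `IsWeightTwoOrdinaryDistinguished.coe_det_apply`), ℤ-integral ARITHMETIC-Frobenius
polynomial (the Weil polynomial of the reduction, P(0) = q²) — the rev-≤4 decls mixed in BCGP's
cohomological multiplier ε⁻¹ and were shown vacuous by
`Summit.Langlands.Langlands.Theorems.SectorComplement.Negative.repeatedRootSocle_sympl_pure_false`
(refuter); they are kept as settled negative knowledge, never re-worded in place.

RANKED CRUXES. #0 UnrefinedWeightTwoLiftingR (target) — p odd prime; k algebraically closed of
characteristic p with reduction map red : 𝒪_ℚ̄_p → k; ρ₀, ρ : Γ_ℚ → GL₄(ℚ̄_p) both irreducible,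
symplectic with multiplier ε (homological convention), of Siegel-parabolic weight-2 ordinary shape
at the place above p (conjugate to block-upper-triangular (εα, εβ | β⁻¹, α⁻¹) with DIAGONAL diagonal
blocks, α, β unramified characters — NO condition α ≠ β), pure of weight 1 at almost all places
(ℤ-integral arithmetic-Frobenius polynomial with Weil roots |z|² = q_v); ρ residually enormous (a
residual σ : Γ_ℚ → GL₄(k) matching ρ a.e. through red, irreducible, containing a regular semisimple
element); ρ₀ automorphic (weak Satake form on GL₄/ℚ, L-algebraic π, the summit's
`SatakeFrobCompatibleAt` clause) and congruent to ρ a.e. through red ⟹ ρ is automorphic. (why it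
might fail: `BigRes` (irreducible + one regular semisimple element) is weaker than BCGP's vast/tidy
image hypotheses and `Aut ρ₀` carries no ordinarity of π₀, so the typed target over-claims at small
images (p = 3, image ⊄ GSp₄(𝔽₃)); true only if Fontaine–Mazur holds in this sector.)
[BoxerCalegariGeePilloni2025, BoxerEtAl2021, arXiv:2502.20645]
#2 LimitClassicalUnrefinedR (crux) — THE HEART (socle classicality). ρ : Γ_ℚ → GL₄(ℚ̄_p)
irreducible, symplectic with multiplier ε, Siegel weight-2 ordinary at p with unramified α, β (α = β
allowed), pure a.e., residually enormous, and a p-ADIC LIMIT of automorphic representations (for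
every m an automorphic ρ_m with Frobenius polynomials ≡ those of ρ mod p^m a.e.) ⟹ ρ automorphic.
Intended proof: BCGP 2025 Thm 277 run on the weight-(2,2) FIBRE of the ordinary higher Hida /
𝔟-cohomology modules (carrier `Literature.NumberTheory.Automorphic.OrdinaryHigherHidaGSp4`, landed)
at the point x of ρ over the Artinian Hecke fibre A = T_x/P (length 2 at a repeated-root crossing):
fibre cyclicity (informal child FibreCyclicity) makes the 𝔪_f-eigenline the socle y·M̄; the Cousin
map is A-linear and ≡ 0 mod y by de Rhamness of ρ on coinvariants V/𝔪_fV (BCGP Rem 279; informal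
child SocleCousinVanishing); so it vanishes on the eigenline, which is therefore classical;
Arthur-packet stability and GSp₄ → GL₄ transfer (GeeTaibi2019) finish. The distinct-root case is
BCGP 2025 §7 + Thm 277; the repeated-root case is new. [difficulty: XL] (why it might fail: H¹ of
the Hida complex is a cokernel, its weight-(2,2) fibre may jump (no cyclicity); a family may be
invisible in some degree (A acts non-faithfully, eigenline ≠ y·M̄); ≥3 families can meet when
Frobenius is scalar (A not Gorenstein); BCGP Rem 279 (coinvariants) is asserted, not proved.)
[BoxerCalegariGeePilloni2025, Pan2022LocallyAnalytic, CalegariGeraghty2017,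
doi:10.1007/s002220050189, GeeTaibi2019]
#3 PadicLimitUnrefinedR (crux) — p-ADIC AUTOMORPHY WITHOUT REFINEMENT. Under the target's hypotheses
(ρ₀ automorphic, congruent a.e. to ρ; both irreducible, symplectic with multiplier ε, Siegel
weight-2 ordinary at p with no distinctness, pure a.e.; ρ residually enormous), ρ is a p-adic limit
of automorphic representations: for every m there is an automorphic ρ_m : Γ_ℚ → GL₄(ℚ̄_p) whose
Frobenius polynomials are ≡ those of ρ modulo p^m at almost all places. Intended proof: BCGP 2021 §7
/ BCGP 2025 §§6–7 Taylor–Wiles patching of ordinary higher-Hida complexes gives R^red[1/p] = T[1/p]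
in a neighbourhood of the prime 𝔮 of ρ ("M_𝔮 ≠ 0", printed without distinguishedness 'in principle',
p.104), so the eigensystem of ρ is a char-0 point of the Hida family and ρ is the limit of the
Galois representations of classical regular-weight ordinary points accumulating at x. Residually
distinguished case = BCGP 2021; residually non-distinguished = BCGP 2025 neighbourhood argument.
[difficulty: L] (why it might fail: at a repeated-root point 𝔮 lies on TWO crossing components and
BCGP's neighbourhood R^red[1/p]=T[1/p] must hit a component specialising to ρ; their 'further local
complications' are printed only up to the p-distinguished freeness step; BigRes is weaker than
vast/tidy.) [BoxerEtAl2021, BoxerCalegariGeePilloni2025, arXiv:1812.09269]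
#9 SectorComplementR (crux) — COMPLEMENT OF THE SECTOR = the rest of the summit:
UnrefinedWeightTwoLiftingR → Langlands (every n ≠ 4, every F ≠ ℚ, direction (A), local–global
compatibility at every place, the reciprocity data 𝓡, all of (B) outside symplectic weight-2
ordinary ρ over ℚ). Not attacked by this route, never staffed from it; filed as a crux so that
`closes` has every hypothesis declared (same convention as
EisensteinGelfandKirillov.SectorComplement, PhantomRMYoshida.PhantomRMJunction); S → C holds
trivially (BC7 informational crux.summit-implies), C → S does not (the repaired sector is not
vacuous). [difficulty: open-problem] (why it might fail: it IS the open reciprocity conjecture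
outside one GSp₄/ℚ sector; `Langlands` as typed may over-claim in corners (irregular π, even ρ).
Imported complement; judge the route on items 2–3.) [BuzzardGeeLMS2014, FontaineMazurGeometric1995,
Calegari2023]
LEGACY (aside, settled negative knowledge, never staffed): UnrefinedWeightTwoLifting,
LimitClassicalUnrefined, PadicLimitUnrefined (multiplier ε⁻¹; hypotheses unsatisfiable, hold ex
falso — `RepeatedRootSocleVacuity.lean`), SectorComplement (↔ Langlands,
`sectorComplement_iff_langlands`), and the frame item Assembly over them (pure logic, derived inline
in `closes`).

TWO-LAYER PLAN. LimitClassicalUnrefinedR ⇐ FibreCyclicity → SocleCousinVanishing →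
LimitClassicalUnrefinedR (the two informal items stmt-Langlands-18094/18095, now typable over the
landed carrier `OrdinaryHigherHidaGSp4` — as registered skeleton stubs of LimitClassicalUnrefinedR
(crux-plan Lines/<slug>.lean) or as --split children in tenure, not as free-standing top-level
decls): FibreCyclicity = the weight-(2,2) fibres M̄^(i) (i = 0..3) of the ordinary higher Hida /
Coleman cohomologies at x are cyclic A-modules and the fibre sequences of the Sen–Cousin filtration
are exact; SocleCousinVanishing = Cousin map A-linear, ≡ 0 mod y by de Rhamness on V/𝔪_fV, hence 0
on the socle. PadicLimitUnrefinedR ⇐ (residually distinguished, BCGP 2021) + (neighbourhood R^red=T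
at a crossing point).

KILL CRITERIA. (K0, consumed) Vacuity of the rev-≤4 typing (multiplier ε⁻¹ vs ℤ-integral
arithmetic-Frobenius polynomial; refuter theorem `repeatedRootSocle_sympl_pure_false`) — repaired by
the R-items with multiplier ε; a refuter re-running the same determinant test on the R-items gets
det² = ε⁴ ⇒ P(0)² = q⁴, consistent (P(0) = q²); any NEW joint-unsatisfiability proof of the
R-hypotheses (Sympl-ε, PSh, Pure, Aut, BigRes, Cong) closes the route `refuted` as misstated-twice.
(K1) A counterexample to FibreCyclicity in print or by computation — an ordinary abelian surface A/ℚ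
with repeated unit roots at p whose weight-(2,2) ordinary H⁰- and H¹-eigenspaces at x have different
dimensions, or a third p-adic family through x — refutes the mechanism: close
`refuted:LimitClassicalUnrefinedR` if the typed statement is hit, else pivot to the level-prime-to-p
torsion (Calegari–Geraghty) variant. (K2) If BCGP (or anyone) removes condition (3) of their Thm 1.1
in print, the route is `superseded`. (K3) A refuter showing that BCGP Rem 279's coinvariant variant
fails (V/𝔪_fV not D_Sen(ρ)-isotypic) kills SocleCousinVanishing; then the line needs multiplicity ≤
3 instead (dimension-parity variant of Pan's paradox: dim V[𝔪_f] ∈ 4ℤ) — pivot, not close.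

NOT DECOMPOSED YET. The Galois structure of the coinvariants V/𝔪_fV (Chebotarev + enormous image
over the Artinian fibre: a Carayol-type lemma); exactness of the fibre sequences for the H¹/H²
pieces (cokernels of the Hida complex); Arthur-packet bookkeeping for the final H⁰-step with both
refinements counted; the image-hypothesis gap BigRes vs vast/tidy; p = 2. All are layer-2 children
or supports of LimitClassicalUnrefinedR.

CHEAPEST FALSIFIER. CONVENTION TEST (run 2026-08-17 by a refuter on rev 2, fired; re-run mentally on
the repair, passes): symplectic multiplier ν and the constant term of the integral
arithmetic-Frobenius polynomial must satisfy P(0)² = ν(σ_v)⁴ — with ν = ε this is q⁴ = q⁴. LOOKUP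
(run, negative so far): does arXiv:2502.20645 or a sequel already treat repeated roots? — §1.1 keeps
the clause, §7 p.104 names it as the obstruction, p.3 calls relaxing the local conditions "marginal
improvement … or base change to totally real fields". COMPUTE (for a refuter/ccert seat, one kit
job): among LMFDB genus-2 curves with surjective mod-3 image and good ordinary reduction at 3, list
those whose Euler factor at 3 has a repeated unit root (explicit finite list by the Weil bounds) and
check them against Poor–Yuen paramodular tables at the predicted level: a non-match would refute the
TARGET (and BCGP's conjecture 1.x), a match is the expected calibration.

NUMBERS. BCGP 2025 Thm 1.1 applies to 11743 of 66158 LMFDB genus-2 curves (arXiv:2502.20645 §1.1);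
the repeated-root clause is a congruence condition at 3 of positive density among 3-ordinary
surfaces (finitely many Frobenius polynomials x⁴ − a₁x³ + a₂x² − 3a₁x + 9 with repeated unit root,
|a₁| ≤ 6). Fibre length at a simple crossing: 2; Galois side dim V[𝔪] ∈ 4ℤ (BCGP Lemma
Galois-rep-cc). Items after the repair: 4 live typed (target R, 2 cruxes R, complement R) + 2
informal cruxes + 5 legacy (4 aside + the derived frame item Assembly) = 11 ≤ 15.

DEFINITION REQUESTS. Carrier for BCGP's ordinary higher-Hida complexes / ordinary 𝔟-cohomology of
the Siegel threefold with Hecke action: LANDED as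
`Literature.NumberTheory.Automorphic.OrdinaryHigherHidaGSp4` (M/H/V, cousinLow/High, sen, fil,
IsCyclicAt, coinvariantsAt, HasSenCousin, CousinKernelAutomorphic) — FibreCyclicity /
SocleCousinVanishing are now typable against it. No new Literature facts requested: BCGP 2025 Thm
277 / Sen–Cousin enter as cited sources of the informal children, not as hypotheses of `closes`.

Novelty: Searches (2026-08-17): `lit search --source arxiv "locally analytic vectors completed cohomology
Shimura curves"` (4: Qiu–Su 2505.10290, Li–Su–Wu 2601.13625, Dospinescu–Paškūnas–Schraen 2201.12922,
Matsumoto 2512.04641 — all REGULAR weight, none GSp₄); `lit read arxiv:2502.20645 --grep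
distinguished|multiplicity one|classicality` (BCGP 2025: Thm 277, §7 p.104, Lemma 324, Rem 279 read
at page level); `lit read arxiv:1812.09269 --grep distinguished` (BCGP 2021 Def 376 good primes);
`lit read arxiv:2109.14145` §4 fn.14 (GL₂ coincident-eigenvalue history); `lit read arxiv:1207.4224
--grep distinct eigenvalues` (CG Cor 1.4, Rem 3.9); `lit read arxiv:2008.07099` Thm 1.0.2–1.0.5
(Pan); `lit search --source zbmath "strong Artin conjecture totally real"` (12; killed the
weight-one sibling as a target: Calegari survey says resolved); galaxy `--star all` ×6
(Pilloni–Stroh, Sasaki: no text held); tree: grep of all 89 Theses for distinguished/repeated root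
(only as an ASSUMED hypothesis: AbelianSurfaceSerre, RegularSerreAbelianSurfaces,
PhantomRM(Yoshida), GSpin*, K3SpinSixteen, OccultE6Transport).
Nearest prior art found: BoxerCalegariGeePilloni2025 (arXiv:2502.20645) Thm 277 + Rem 279 (Pan-style
classicality for ordinary p-adic Siegel forms; coinvariant variant mentioned) and §7 (multiplicity
one needs distinct roots); CalegariGeraghty2017 Cor 1.4 / Pan2022LocallyAnalytic Thm 1.0.3 (the GL₂
weight-one mechanism being transferred).
Delta: replace BCGP's multiplicity-one input by cyclicit  [refs: 2502.20645, 1812.09269, 2109.14145, 1207.4224, 2008.07099, arxiv:2502.20645, arxiv:1812.09269, arxiv:2109.14145, arxiv:1207.4224, arxiv:2008.07099, BoxerCalegariGeePilloni2025, CalegariGeraghty2017]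

Barriers (technique_class: higher-hida-theory sen-cousin socle-fibre): - technique_class: higher-hida-theory sen-cousin socle-fibre
- Literature.Barriers.Langlands.PatchingLocalComponentBarrier: ENGAGED and named — the
Borel-ordinary local ring is singular at the repeated-root point (two flags / a P¹, BCGP Lemma 324)
and Diamond freeness fails; the line evades it by never asking for regularity: it needs only the
length of the Hecke fibre and A-linearity of the Cousin map (PadicLimitUnrefined still uses BCGP's
patching, on the ordinary component only, as printed).
- Literature.Barriers.Langlands.TaylorWilesNumericalCoincidence: ℓ₀ = 1 for weight (2,2) on GSp₄/ℚ;
handled by BCGP's higher-Hida two-term complexes (imported inside PadicLimitUnrefined), not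
re-fought here.
- Literature.Barriers.Langlands.NonRegularWeightBarrier: weight (2,2) is singular; the barrier's own
evasions (coherent cohomology of limits of discrete series, p-adic interpolation) are exactly BCGP's
setting; the route adds nothing Betti-cohomological.
- Literature.Barriers.Langlands.ResiduallyReducibleBarrier: not met — residually enormous
(irreducible with a regular semisimple element) by hypothesis; the residually reducible weight-(2,2)
case is PhantomRMYoshida's.
- Literature.Barriers.Langlands.ModPLanglandsGL2BeyondQpFpBar: not engaged — F = ℚ, and the Pan/BCGP
classicality uses no p-adic local Langlands correspondence (same for PaskunasCentreFinitenessFails).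
- Literature.Barriers.Langlands.ShimuraVarietyRealizationBarrier: respected — GSp₄/ℚ has a Shimura
variety and ρ is s

History (route lifecycle, newest last):
- 2026-08-24T09:49:19Z · DORMANT — reconciler: no traction for 6.7 d (last activity item-evidence-added at 2026-08-17T16:56:34Z); parked, not closed — `ledger route dormant route-Langlands-Repeat (operator:999:585823)

sub-problem: Langlands · status: dormant · opened planner-plan-novel-Langlands-Langlands-e266a39d-b-v2-g22-0 2026-08-17T11:22:58Z · rev 5 · ledger route-Langlands-RepeatedRootSocle
GENERATED by the gate from the ledger (D-0016/17). Provers cite these decls: `theorem foo : Summit.Langlands.Langlands.Theses.RepeatedRootSocle.<Decl> := …` in Summits/Langlands/Langlands/Theorems/<Name>.lean.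
-/

namespace Summit.Langlands.Langlands.Theses.RepeatedRootSocle

open scoped BigOperators Topology Manifold Classical MeasureTheory ProbabilityTheory Matrix InnerProductSpace ComplexConjugate ContinuousMap
open Filter Set Function TopologicalSpace MeasureTheory

attribute [summit_statement] _root_.Langlands

/-- item stmt-Langlands-18143 · target · rank 0 · open · by planner
why it might fail: `BigRes` (irreducible + one regular semisimple element) is weaker than BCGP's vast/tidy image hypotheses and `Aut ρ₀` carries no ordinarity of π₀, so the typed target over-claims at small images (p = 3, image ⊄ GSp₄(𝔽₃)); true only if Fontaine–Mazur holds in this sector.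
sources: BoxerCalegariGeePilloni2025, arXiv:2502.20645, BoxerEtAl2021, arXiv:1812.09269
[target] REPAIRED target (2026-08-17; supersedes the vacuous rev-≤4 `UnrefinedWeightTwoLifting`,
whose multiplier ε⁻¹ clashed with its own ℤ-integral arithmetic-Frobenius polynomial —
`Theorems/SectorComplement/Negative/RepeatedRootSocleVacuity.lean`). HOMOLOGICAL convention ρ ≈
V_p(A) throughout: p odd prime; k algebraically closed of characteristic p with reduction map red :
𝒪_ℚ̄_p → k; ρ₀, ρ : Γ_ℚ → GL₄(ℚ̄_p) both irreducible, symplectic with multiplier the cyclotomic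
character ε (so det = ε²), of Siegel-parabolic weight-2 ordinary shape at the place above p
(conjugate to block-upper-triangular (εα, εβ | β⁻¹, α⁻¹) with DIAGONAL diagonal blocks, α, β
unramified characters — NO condition α ≠ β; the shape of `IsWeightTwoOrdinaryDistinguishedAt` minus
residual distinctness), pure of weight 1 at almost all places (ℤ-integral arithmetic-Frobenius
polynomial — the Weil polynomial of the reduction, P(0) = q² — all complex roots |z|² = q_v); ρ
residually enormous (a residual σ : Γ_ℚ → GL₄(k) matching ρ a.e. through red, irreducible,
containing a regular semisimple element); ρ₀ automorphic (weak Satake form on GL₄/ℚ: an L-algebraic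
cuspidal π with the summit's `SatakeFrobCompatibleAt` cla -/
@[route_item "route-Langlands-RepeatedRootSocle"]
def UnrefinedWeightTwoLiftingR : Prop :=
  ∀ (p : ℕ) [Fact p.Prime], p ≠ 2 → ∀ (k : Type) [Field k] [CharP k p] [IsAlgClosed k] [TopologicalSpace k] [DiscreteTopology k] (red : Valued.integer (PadicAlgCl p) →+* k) (hcpt : Literature.NumberTheory.Automorphic.isCompact_glFiniteIntegralLevel 4 ℚ) (ι : PadicAlgCl p ≃+* ℂ), let R4 := Literature.NumberTheory.GaloisRepresentations.FramedGaloisRep ℚ (PadicAlgCl p) 4; let Pl := IsDedekindDomain.HeightOneSpectrum (NumberField.RingOfIntegers ℚ); ∀ (ρ₀ ρ : R4), let Sympl := fun r : R4 => r.IsSymplecticWithMultiplierFun (fun g => algebraMap ℚ_[p] (PadicAlgCl p) (((Literature.NumberTheory.GaloisRepresentations.GaloisRep.cyclotomicCharacter ℚ p g : ℤ_[p]ˣ) : ℤ_[p]) : ℚ_[p])); let PSh := fun (r : R4) (v : Pl) => ∃ (g : Matrix.GeneralLinearGroup (Fin 4) (PadicAlgCl p)) (α β : Field.absoluteGaloisGroup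 (v.adicCompletion ℚ) →* (PadicAlgCl p)ˣ), (∀ τ ∈ Literature.NumberTheory.GaloisRepresentations.absInertia (v.adicCompletion ℚ), α τ = 1 ∧ β τ = 1) ∧ ∀ τ, (∀ i j : Fin 4, j < i → (g⁻¹ * r.toLocal v τ * g).val i j = 0) ∧ (g⁻¹ * r.toLocal v τ * g).val 0 1 = 0 ∧ (g⁻¹ * r.toLocal v τ * g).val 2 3 = 0 ∧ (g⁻¹ * r.toLocal v τ * g).val 0 0 = algebraMap ℚ_[p] (PadicAlgCl p) (((Literature.NumberTheory.GaloisRepresentations.GaloisRep.cyclotomicCharacter (v.adicCompletion ℚ) p τ : ℤ_[p]ˣ) : ℤ_[p]) : ℚ_[p]) * α τ ∧ (g⁻¹ * r.toLocal v τ * g).val 1 1 = algebraMap ℚ_[p] (PadicAlgCl p) (((Literature.NumberTheory.GaloisRepresentations.GaloisRep.cyclotomicCharacter (v.adicCompletion ℚ) p τ : ℤ_[p]ˣ) : ℤ_[p]) : ℚ_[p]) * β τ ∧ (g⁻¹ * r.toLocal v τ * g).val 2 2 = ((β τ)⁻¹ : (PadicAlgCl p)ˣ) ∧ (g⁻¹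 * r.toLocal v τ * g).val 3 3 = ((α τ)⁻¹ : (PadicAlgCl p)ˣ); let Pure := fun r : R4 => ∀ᶠ v : Pl in Filter.cofinite, r.IsUnramifiedAt v ∧ ∃ P : Polynomial ℤ, r.HasFrobCharpolyAt v (P.map (Int.castRingHom (PadicAlgCl p))) ∧ ∀ z : ℂ, (P.map (Int.castRingHom ℂ)).IsRoot z → ‖z‖ ^ 2 = (v.residueCard : ℝ); let Cong := fun r r' : R4 => ∀ᶠ v : Pl in Filter.cofinite, ∃ P P' : Polynomial (Valued.integer (PadicAlgCl p)), r.HasFrobCharpolyAt v (P.map (Valued.integer (PadicAlgCl p)).subtype) ∧ r'.HasFrobCharpolyAt v (P'.map (Valued.integer (PadicAlgCl p)).subtype) ∧ P.map red = P'.map red; let BigRes := fun r : R4 => ∃ σ : Literature.NumberTheory.GaloisRepresentations.FramedGaloisRep ℚ k 4, (∀ᶠ v : Pl in Filter.cofinite, ∃ (P : Polynomial (Valued.integer (PadicAlgCl p))) (Pb : Polynomial k), r.HasFrobCharpolyAt v (P.map (Valued.integer (PadicAlgCl p)).subtype) ∧ σ.HasFrobCharpolyAt v Pb ∧ P.map red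 = Pb) ∧ σ.toGaloisRep.IsIrreducible ∧ ∃ x, ((σ x).val.charpoly).Separable; let Aut := fun r : R4 => ∃ π : Literature.NumberTheory.Automorphic.CuspidalAutomorphicRepData 4 ℚ hcpt, π.1.IsLAlgebraic ∧ ∀ᶠ v : Pl in Filter.cofinite, ∃ a : Multiset ℂ, π.1.HasSatakeParamAt v a ∧ r.IsUnramifiedAt v ∧ r.HasFrobCharpolyAt v (Literature.NumberTheory.Automorphic.arithFrobPolyOfSatake ι v.residueCard 1 a); ρ₀.toGaloisRep.IsIrreducible → Sympl ρ₀ → (∀ v : Pl, ((p : ℕ) : NumberField.RingOfIntegers ℚ) ∈ v.asIdeal → PSh ρ₀ v) → Pure ρ₀ → Aut ρ₀ → ρ.toGaloisRep.IsIrreducible → Sympl ρ → (∀ v : Pl, ((p : ℕ) : NumberField.RingOfIntegers ℚ) ∈ v.asIdeal → PSh ρ v) → Pure ρ → BigRes ρ → Cong ρ₀ ρ → Aut ρ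

-- item stmt-Langlands-18094 · crux · rank 2 · open · by planner — informal only, no Lean statement yet:
--   [crux] FIBRE CYCLICITY (layer-2 child of LimitClassicalUnrefined; typed once BCGP higher-Hida /
--   ordinary b-cohomology modules for GSp4 have a Literature carrier). At the characteristic-zero point
--   x of an irreducible symplectic weight-2 P-ordinary pure rho with residually enormous image on
--   Boxer-Calegari-Gee-Pilloni ordinary higher-Hida cohomology of the Siegel threefold localised at
--   m_rhobar, with A := T_x / P T_x the weight-(2,2) Hecke fibre (an Artinian local algebra; length 2 at
--   a simple repeated-root crossing): for each degree i = 0..3 the fibre Mbar^(i) of the ordinary higher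
--   Hida / highe

/-- item stmt-Langlands-18144 · crux · rank 2 · open · by planner
why it might fail: H¹ of the Hida complex is a cokernel, its weight-(2,2) fibre may jump (no cyclicity); a family may be invisible in some degree (A acts non-faithfully, eigenline ≠ y·M̄); ≥3 families can meet when Frobenius is scalar (A not Gorenstein); BCGP Rem 279 (coinvariants) is asserted, not proved.
sources: BoxerCalegariGeePilloni2025, arXiv:2502.20645, Pan2022LocallyAnalytic, CalegariGeraghty2017, doi:10.1007/s002220050189, GeeTaibi2019
[crux] THE HEART (socle classicality) — REPAIRED typing (multiplier ε, homological convention;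
supersedes the vacuous rev-≤4 `LimitClassicalUnrefined`). ρ : Γ_ℚ → GL₄(ℚ̄_p) irreducible,
symplectic with multiplier ε, Siegel weight-2 ordinary at p with unramified α, β (α = β allowed),
pure a.e. (ℤ-integral arithmetic-Frobenius polynomial, Weil roots), residually enormous, and a
p-ADIC LIMIT of automorphic representations (for every m an automorphic ρ_m with Frobenius
polynomials ≡ those of ρ mod p^m a.e.) ⟹ ρ automorphic. Intended proof: BCGP 2025 Thm 277 run on the
weight-(2,2) FIBRE of the ordinary higher Hida / 𝔟-cohomology modules (carrier
`Literature.NumberTheory.Automorphic.OrdinaryHigherHidaGSp4`) at the point x of ρ over the Artinian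
Hecke fibre A = T_x/P (length 2 at a repeated-root crossing): fibre cyclicity (informal child
FibreCyclicity, stmt-Langlands-18094) makes the 𝔪_f-eigenline the socle y·M̄; the Cousin map is
A-linear and ≡ 0 mod y by de Rhamness of ρ on coinvariants V/𝔪_fV (BCGP Rem 279; informal child
SocleCousinVanishing, stmt-Langlands-18095); so it vanishes on the eigenline, which is therefore
classical; Arthur-packet stability and GSp₄ → GL₄ transfer (GeeTaib -/
@[route_item "route-Langlands-RepeatedRootSocle", crux]
def LimitClassicalUnrefinedR : Prop :=
  ∀ (p : ℕ) [Fact p.Prime], p ≠ 2 → ∀ (k : Type) [Field k] [CharP k p] [IsAlgClosed k] [TopologicalSpace k] [DiscreteTopology k] (red : Valued.integer (PadicAlgCl p) →+* k) (hcpt : Literature.NumberTheory.Automorphic.isCompact_glFiniteIntegralLevel 4 ℚ) (ι : PadicAlgCl p ≃+* ℂ), let R4 := Literature.NumberTheory.GaloisRepresentations.FramedGaloisRep ℚ (PadicAlgCl p) 4; let Pl := IsDedekindDomain.HeightOneSpectrum (NumberField.RingOfIntegers ℚ); ∀ (ρ : R4), let Sympl := fun r : R4 => r.IsSymplecticWithMultiplierFun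 (fun g => algebraMap ℚ_[p] (PadicAlgCl p) (((Literature.NumberTheory.GaloisRepresentations.GaloisRep.cyclotomicCharacter ℚ p g : ℤ_[p]ˣ) : ℤ_[p]) : ℚ_[p])); let PSh := fun (r : R4) (v : Pl) => ∃ (g : Matrix.GeneralLinearGroup (Fin 4) (PadicAlgCl p)) (α β : Field.absoluteGaloisGroup (v.adicCompletion ℚ) →* (PadicAlgCl p)ˣ), (∀ τ ∈ Literature.NumberTheory.GaloisRepresentations.absInertia (v.adicCompletion ℚ), α τ = 1 ∧ β τ = 1) ∧ ∀ τ, (∀ i j : Fin 4, j < i → (g⁻¹ * r.toLocal v τ * g).val i j = 0) ∧ (g⁻¹ * r.toLocal v τ * g).val 0 1 = 0 ∧ (g⁻¹ * r.toLocal v τ * g).val 2 3 = 0 ∧ (g⁻¹ * r.toLocal v τ * g).val 0 0 = algebraMap ℚ_[p] (PadicAlgCl p) (((Literature.NumberTheory.GaloisRepresentations.GaloisRep.cyclotomicCharacter (v.adicCompletion ℚ) p τ : ℤ_[p]ˣ) : ℤ_[p]) : ℚ_[p]) * α τ ∧ (g⁻¹ * r.toLocal v τ * g).val 1 1 = algebraMap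 ℚ_[p] (PadicAlgCl p) (((Literature.NumberTheory.GaloisRepresentations.GaloisRep.cyclotomicCharacter (v.adicCompletion ℚ) p τ : ℤ_[p]ˣ) : ℤ_[p]) : ℚ_[p]) * β τ ∧ (g⁻¹ * r.toLocal v τ * g).val 2 2 = ((β τ)⁻¹ : (PadicAlgCl p)ˣ) ∧ (g⁻¹ * r.toLocal v τ * g).val 3 3 = ((α τ)⁻¹ : (PadicAlgCl p)ˣ); let Pure := fun r : R4 => ∀ᶠ v : Pl in Filter.cofinite, r.IsUnramifiedAt v ∧ ∃ P : Polynomial ℤ, r.HasFrobCharpolyAt v (P.map (Int.castRingHom (PadicAlgCl p))) ∧ ∀ z : ℂ, (P.map (Int.castRingHom ℂ)).IsRoot z → ‖z‖ ^ 2 = (v.residueCard : ℝ); let BigRes := fun r : R4 => ∃ σ : Literature.NumberTheory.GaloisRepresentations.FramedGaloisRep ℚ k 4, (∀ᶠ v : Pl in Filter.cofinite, ∃ (P : Polynomial (Valued.integer (PadicAlgCl p))) (Pb : Polynomial k), r.HasFrobCharpolyAt v (P.map (Valued.integer (PadicAlgCl p)).subtype) ∧ σ.HasFrobCharpolyAt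 v Pb ∧ P.map red = Pb) ∧ σ.toGaloisRep.IsIrreducible ∧ ∃ x, ((σ x).val.charpoly).Separable; let Aut := fun r : R4 => ∃ π : Literature.NumberTheory.Automorphic.CuspidalAutomorphicRepData 4 ℚ hcpt, π.1.IsLAlgebraic ∧ ∀ᶠ v : Pl in Filter.cofinite, ∃ a : Multiset ℂ, π.1.HasSatakeParamAt v a ∧ r.IsUnramifiedAt v ∧ r.HasFrobCharpolyAt v (Literature.NumberTheory.Automorphic.arithFrobPolyOfSatake ι v.residueCard 1 a); let Lim := fun r : R4 => ∀ m : ℕ, ∃ r' : R4, Aut r' ∧ ∀ᶠ v : Pl in Filter.cofinite, ∃ P P' : Polynomial (Valued.integer (PadicAlgCl p)), r.HasFrobCharpolyAt v (P.map (Valued.integer (PadicAlgCl p)).subtype) ∧ r'.HasFrobCharpolyAt v (P'.map (Valued.integer (PadicAlgCl p)).subtype) ∧ ∀ i : ℕ, ((p : ℕ) : Valued.integer (PadicAlgCl p)) ^ m ∣ (P - P').coeff i; ρ.toGaloisRep.IsIrreducible → Sympl ρ → (∀ v : Pl, ((p : ℕ) : NumberField.RingOfIntegers ℚ) ∈ v.asIdeal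 → PSh ρ v) → Pure ρ → BigRes ρ → Lim ρ → Aut ρ

/-- item stmt-Langlands-18145 · crux · rank 3 · open · by planner
why it might fail: at a repeated-root point 𝔮 lies on TWO crossing components and BCGP's neighbourhood R^red[1/p]=T[1/p] must hit a component specialising to ρ; their 'further local complications' are printed only up to the p-distinguished freeness step; BigRes is weaker than vast/tidy.
sources: BoxerEtAl2021, arXiv:1812.09269, BoxerCalegariGeePilloni2025, arXiv:2502.20645
[crux] p-ADIC AUTOMORPHY WITHOUT REFINEMENT — REPAIRED typing (multiplier ε, homological convention;
supersedes the vacuous rev-≤4 `PadicLimitUnrefined`). Under the repaired target's hypotheses (ρ₀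
automorphic, congruent a.e. to ρ; both irreducible, symplectic with multiplier ε, Siegel weight-2
ordinary at p with no distinctness, pure a.e.; ρ residually enormous), ρ is a p-adic limit of
automorphic representations: for every m there is an automorphic ρ_m : Γ_ℚ → GL₄(ℚ̄_p) whose
Frobenius polynomials are ≡ those of ρ modulo p^m at almost all places. Intended proof: BCGP 2021 §7
/ BCGP 2025 §§6–7 Taylor–Wiles patching of ordinary higher-Hida complexes gives R^red[1/p] = T[1/p]
in a neighbourhood of the prime 𝔮 of ρ ('M_𝔮 ≠ 0', printed without distinguishedness 'in principle',
p.104), so the eigensystem of ρ is a char-0 point of the Hida family and ρ is the limit of the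
Galois representations of classical regular-weight ordinary points accumulating at x. Residually
distinguished case = BCGP 2021; residually non-distinguished = BCGP 2025 neighbourhood argument.
[difficulty: L] -/
@[route_item "route-Langlands-RepeatedRootSocle", crux]
def PadicLimitUnrefinedR : Prop :=
  ∀ (p : ℕ) [Fact p.Prime], p ≠ 2 → ∀ (k : Type) [Field k] [CharP k p] [IsAlgClosed k] [TopologicalSpace k] [DiscreteTopology k] (red : Valued.integer (PadicAlgCl p) →+* k) (hcpt : Literature.NumberTheory.Automorphic.isCompact_glFiniteIntegralLevel 4 ℚ) (ι : PadicAlgCl p ≃+* ℂ), let R4 := Literature.NumberTheory.GaloisRepresentations.FramedGaloisRep ℚ (PadicAlgCl p) 4; let Pl := IsDedekindDomain.HeightOneSpectrum (NumberField.RingOfIntegers ℚ); ∀ (ρ₀ ρ : R4), let Sympl := fun r : R4 => r.IsSymplecticWithMultiplierFun (fun g => algebraMap ℚ_[p] (PadicAlgCl p) (((Literature.NumberTheory.GaloisRepresentations.GaloisRep.cyclotomicCharacter ℚ p g : ℤ_[p]ˣ) : ℤ_[p]) : ℚ_[p])); let PSh := fun (r : R4) (v : Pl) => ∃ (g : Matrix.GeneralLinearGroup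 (Fin 4) (PadicAlgCl p)) (α β : Field.absoluteGaloisGroup (v.adicCompletion ℚ) →* (PadicAlgCl p)ˣ), (∀ τ ∈ Literature.NumberTheory.GaloisRepresentations.absInertia (v.adicCompletion ℚ), α τ = 1 ∧ β τ = 1) ∧ ∀ τ, (∀ i j : Fin 4, j < i → (g⁻¹ * r.toLocal v τ * g).val i j = 0) ∧ (g⁻¹ * r.toLocal v τ * g).val 0 1 = 0 ∧ (g⁻¹ * r.toLocal v τ * g).val 2 3 = 0 ∧ (g⁻¹ * r.toLocal v τ * g).val 0 0 = algebraMap ℚ_[p] (PadicAlgCl p) (((Literature.NumberTheory.GaloisRepresentations.GaloisRep.cyclotomicCharacter (v.adicCompletion ℚ) p τ : ℤ_[p]ˣ) : ℤ_[p]) : ℚ_[p]) * α τ ∧ (g⁻¹ * r.toLocal v τ * g).val 1 1 = algebraMap ℚ_[p] (PadicAlgCl p) (((Literature.NumberTheory.GaloisRepresentations.GaloisRep.cyclotomicCharacter (v.adicCompletion ℚ) p τ : ℤ_[p]ˣ) : ℤ_[p]) : ℚ_[p]) * β τ ∧ (g⁻¹ * r.toLocal v τ * g).val 2 2 = ((β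 τ)⁻¹ : (PadicAlgCl p)ˣ) ∧ (g⁻¹ * r.toLocal v τ * g).val 3 3 = ((α τ)⁻¹ : (PadicAlgCl p)ˣ); let Pure := fun r : R4 => ∀ᶠ v : Pl in Filter.cofinite, r.IsUnramifiedAt v ∧ ∃ P : Polynomial ℤ, r.HasFrobCharpolyAt v (P.map (Int.castRingHom (PadicAlgCl p))) ∧ ∀ z : ℂ, (P.map (Int.castRingHom ℂ)).IsRoot z → ‖z‖ ^ 2 = (v.residueCard : ℝ); let Cong := fun r r' : R4 => ∀ᶠ v : Pl in Filter.cofinite, ∃ P P' : Polynomial (Valued.integer (PadicAlgCl p)), r.HasFrobCharpolyAt v (P.map (Valued.integer (PadicAlgCl p)).subtype) ∧ r'.HasFrobCharpolyAt v (P'.map (Valued.integer (PadicAlgCl p)).subtype) ∧ P.map red = P'.map red; let BigRes := fun r : R4 => ∃ σ : Literature.NumberTheory.GaloisRepresentations.FramedGaloisRep ℚ k 4, (∀ᶠ v : Pl in Filter.cofinite, ∃ (P : Polynomial (Valued.integer (PadicAlgCl p))) (Pb : Polynomial k), r.HasFrobCharpolyAt v (P.map (Valued.integer (PadicAlgCl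 p)).subtype) ∧ σ.HasFrobCharpolyAt v Pb ∧ P.map red = Pb) ∧ σ.toGaloisRep.IsIrreducible ∧ ∃ x, ((σ x).val.charpoly).Separable; let Aut := fun r : R4 => ∃ π : Literature.NumberTheory.Automorphic.CuspidalAutomorphicRepData 4 ℚ hcpt, π.1.IsLAlgebraic ∧ ∀ᶠ v : Pl in Filter.cofinite, ∃ a : Multiset ℂ, π.1.HasSatakeParamAt v a ∧ r.IsUnramifiedAt v ∧ r.HasFrobCharpolyAt v (Literature.NumberTheory.Automorphic.arithFrobPolyOfSatake ι v.residueCard 1 a); let Lim := fun r : R4 => ∀ m : ℕ, ∃ r' : R4, Aut r' ∧ ∀ᶠ v : Pl in Filter.cofinite, ∃ P P' : Polynomial (Valued.integer (PadicAlgCl p)), r.HasFrobCharpolyAt v (P.map (Valued.integer (PadicAlgCl p)).subtype) ∧ r'.HasFrobCharpolyAt v (P'.map (Valued.integer (PadicAlgCl p)).subtype) ∧ ∀ i : ℕ, ((p : ℕ) : Valued.integer (PadicAlgCl p)) ^ m ∣ (P - P').coeff i; ρ₀.toGaloisRep.IsIrreducible → Sympl ρ₀ → (∀ v : Pl, ((p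 : ℕ) : NumberField.RingOfIntegers ℚ) ∈ v.asIdeal → PSh ρ₀ v) → Pure ρ₀ → Aut ρ₀ → ρ.toGaloisRep.IsIrreducible → Sympl ρ → (∀ v : Pl, ((p : ℕ) : NumberField.RingOfIntegers ℚ) ∈ v.asIdeal → PSh ρ v) → Pure ρ → BigRes ρ → Cong ρ₀ ρ → Lim ρ

/-- item stmt-Langlands-18146 · crux · rank 9 · open · by planner
why it might fail: it IS the open reciprocity conjecture outside one GSp₄/ℚ sector; `Langlands` as typed may over-claim in corners (irregular π, even ρ). Imported complement; judge the route on LimitClassicalUnrefinedR / PadicLimitUnrefinedR, never staff it from this route.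
sources: BuzzardGeeLMS2014, FontaineMazurGeometric1995, Calegari2023
[crux] COMPLEMENT OF THE SECTOR over the REPAIRED target = the rest of the summit:
UnrefinedWeightTwoLiftingR → Langlands (every n ≠ 4, every F ≠ ℚ, direction (A), local–global
compatibility at every place, the reciprocity data 𝓡, all of (B) outside symplectic weight-2
ordinary ρ over ℚ). Not attacked by this route, never staffed from it; filed as a crux so that
`closes` has every hypothesis declared (same convention as
EisensteinGelfandKirillov.SectorComplement, PhantomRMYoshida.PhantomRMJunction). Supersedes the
rev-≤4 `SectorComplement`, which is ↔ Langlands because its sector was vacuous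
(`sectorComplement_iff_langlands`); for the repaired junction only S → C is trivial (BC7
informational crux.summit-implies), C → S is the sector theorem. [deps: UnrefinedWeightTwoLiftingR]
[difficulty: open-problem] -/
@[route_item "route-Langlands-RepeatedRootSocle", crux]
def SectorComplementR : Prop :=
  UnrefinedWeightTwoLiftingR → _root_.Langlands

/-- item stmt-Langlands-18086 · aside · rank 0 · open · by planner
why it might fail: `BigRes` (irreducible + one regular semisimple element) is weaker than BCGP's vast/tidy image hypotheses and `Aut ρ₀` carries no ordinarity of π₀, so the typed target over-claims at small images (p = 3, image ⊄ GSp₄(𝔽₃)); true only if Fontaine–Mazur holds in this sector.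
sources: BoxerCalegariGeePilloni2025, arXiv:2502.20645, BoxerEtAl2021, arXiv:1812.09269
[target] p odd prime; k algebraically closed of characteristic p with reduction map red : 𝒪_ℚ̄_p →
k; ρ₀, ρ : Γ_ℚ → GL₄(ℚ̄_p) both irreducible, symplectic with multiplier ε⁻¹, of Siegel-parabolic
weight-2 ordinary shape at the place above p (conjugate to block-upper-triangular (εα, εβ | β⁻¹,
α⁻¹) with DIAGONAL diagonal blocks, α, β unramified characters — NO condition α ≠ β), pure of weight
1 at almost all places (integral Frobenius polynomial with Weil roots); ρ residually enormous (a
residual σ : Γ_ℚ → GL₄(k) matching ρ a.e. through red, irreducible, containing a regular semisimple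
element); ρ₀ automorphic (weak Satake form on GL₄/ℚ) and congruent to ρ a.e. through red ⟹ ρ is
automorphic. -/
@[route_item "route-Langlands-RepeatedRootSocle"]
def UnrefinedWeightTwoLifting : Prop :=
  ∀ (p : ℕ) [Fact p.Prime], p ≠ 2 → ∀ (k : Type) [Field k] [CharP k p] [IsAlgClosed k] [TopologicalSpace k] [DiscreteTopology k] (red : Valued.integer (PadicAlgCl p) →+* k) (hcpt : Literature.NumberTheory.Automorphic.isCompact_glFiniteIntegralLevel 4 ℚ) (ι : PadicAlgCl p ≃+* ℂ), let R4 := Literature.NumberTheory.GaloisRepresentations.FramedGaloisRep ℚ (PadicAlgCl p) 4; let Pl := IsDedekindDomain.HeightOneSpectrum (NumberField.RingOfIntegers ℚ); ∀ (ρ₀ ρ : R4), let Sympl := fun r : R4 => r.IsSymplecticWithMultiplierFun (fun g => algebraMap ℚ_[p] (PadicAlgCl p) ((((Literature.NumberTheory.GaloisRepresentations.GaloisRep.cyclotomicCharacter ℚ p g)⁻¹ : ℤ_[p]ˣ) : ℤ_[p]) : ℚ_[p])); let PSh := fun (r : R4) (v : Pl) => ∃ (g : Matrix.GeneralLinearGroup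 (Fin 4) (PadicAlgCl p)) (α β : Field.absoluteGaloisGroup (v.adicCompletion ℚ) →* (PadicAlgCl p)ˣ), (∀ τ ∈ Literature.NumberTheory.GaloisRepresentations.absInertia (v.adicCompletion ℚ), α τ = 1 ∧ β τ = 1) ∧ ∀ τ, (∀ i j : Fin 4, j < i → (g⁻¹ * r.toLocal v τ * g).val i j = 0) ∧ (g⁻¹ * r.toLocal v τ * g).val 0 1 = 0 ∧ (g⁻¹ * r.toLocal v τ * g).val 2 3 = 0 ∧ (g⁻¹ * r.toLocal v τ * g).val 0 0 = algebraMap ℚ_[p] (PadicAlgCl p) (((Literature.NumberTheory.GaloisRepresentations.GaloisRep.cyclotomicCharacter (v.adicCompletion ℚ) p τ : ℤ_[p]ˣ) : ℤ_[p]) : ℚ_[p]) * α τ ∧ (g⁻¹ * r.toLocal v τ * g).val 1 1 = algebraMap ℚ_[p] (PadicAlgCl p) (((Literature.NumberTheory.GaloisRepresentations.GaloisRep.cyclotomicCharacter (v.adicCompletion ℚ) p τ : ℤ_[p]ˣ) : ℤ_[p]) : ℚ_[p]) * β τ ∧ (g⁻¹ * r.toLocal v τ * g).val 2 2 = ((β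 τ)⁻¹ : (PadicAlgCl p)ˣ) ∧ (g⁻¹ * r.toLocal v τ * g).val 3 3 = ((α τ)⁻¹ : (PadicAlgCl p)ˣ); let Pure := fun r : R4 => ∀ᶠ v : Pl in Filter.cofinite, r.IsUnramifiedAt v ∧ ∃ P : Polynomial ℤ, r.HasFrobCharpolyAt v (P.map (Int.castRingHom (PadicAlgCl p))) ∧ ∀ z : ℂ, (P.map (Int.castRingHom ℂ)).IsRoot z → ‖z‖ ^ 2 = (v.residueCard : ℝ); let Cong := fun r r' : R4 => ∀ᶠ v : Pl in Filter.cofinite, ∃ P P' : Polynomial (Valued.integer (PadicAlgCl p)), r.HasFrobCharpolyAt v (P.map (Valued.integer (PadicAlgCl p)).subtype) ∧ r'.HasFrobCharpolyAt v (P'.map (Valued.integer (PadicAlgCl p)).subtype) ∧ P.map red = P'.map red; let BigRes := fun r : R4 => ∃ σ : Literature.NumberTheory.GaloisRepresentations.FramedGaloisRep ℚ k 4, (∀ᶠ v : Pl in Filter.cofinite, ∃ (P : Polynomial (Valued.integer (PadicAlgCl p))) (Pb : Polynomial k), r.HasFrobCharpolyAt v (P.map (Valued.integer (PadicAlgCl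 p)).subtype) ∧ σ.HasFrobCharpolyAt v Pb ∧ P.map red = Pb) ∧ σ.toGaloisRep.IsIrreducible ∧ ∃ x, ((σ x).val.charpoly).Separable; let Aut := fun r : R4 => ∃ π : Literature.NumberTheory.Automorphic.CuspidalAutomorphicRepData 4 ℚ hcpt, π.1.IsLAlgebraic ∧ ∀ᶠ v : Pl in Filter.cofinite, ∃ a : Multiset ℂ, π.1.HasSatakeParamAt v a ∧ r.IsUnramifiedAt v ∧ r.HasFrobCharpolyAt v (Literature.NumberTheory.Automorphic.arithFrobPolyOfSatake ι v.residueCard 1 a); ρ₀.toGaloisRep.IsIrreducible → Sympl ρ₀ → (∀ v : Pl, ((p : ℕ) : NumberField.RingOfIntegers ℚ) ∈ v.asIdeal → PSh ρ₀ v) → Pure ρ₀ → Aut ρ₀ → ρ.toGaloisRep.IsIrreducible → Sympl ρ → (∀ v : Pl, ((p : ℕ) : NumberField.RingOfIntegers ℚ) ∈ v.asIdeal → PSh ρ v) → Pure ρ → BigRes ρ → Cong ρ₀ ρ → Aut ρ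

/-- item stmt-Langlands-18087 · aside · rank 2 · open · by planner
why it might fail: H¹ of the Hida complex is a cokernel, its weight-(2,2) fibre may jump (no cyclicity); a family may be invisible in some degree (A acts non-faithfully, eigenline ≠ y·M̄); ≥3 families can meet when Frobenius is scalar (A not Gorenstein); BCGP Rem 279 (coinvariants) is asserted, not proved.
sources: BoxerCalegariGeePilloni2025, arXiv:2502.20645, Pan2022LocallyAnalytic, CalegariGeraghty2017, doi:10.1007/s002220050189, GeeTaibi2019
[crux] THE HEART (socle classicality). ρ : Γ_ℚ → GL₄(ℚ̄_p) irreducible, symplectic-ε⁻¹, Siegel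
weight-2 ordinary at p with unramified α, β (α = β allowed), pure a.e., residually enormous, and a
p-ADIC LIMIT of automorphic representations (for every m an automorphic ρ_m with Frobenius
polynomials ≡ those of ρ mod p^m a.e.) ⟹ ρ automorphic. Intended proof: BCGP 2025 Thm 277 run on the
weight-(2,2) FIBRE of the ordinary higher Hida / 𝔟-cohomology modules at the point x of ρ over the
Artinian Hecke fibre A = T_x/P (length 2 at a repeated-root crossing): fibre cyclicity (informal
child FibreCyclicity) makes the 𝔪_f-eigenline the socle y·M̄; the Cousin map is A-linear and ≡ 0 mod
y by de Rhamness of ρ on coinvariants V/𝔪_fV (BCGP Rem 279; informal child SocleCousinVanishing); so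
it vanishes on the eigenline, which is therefore classical; Arthur-packet stability and GSp₄ → GL₄
transfer (GeeTaibi2019) finish. The distinct-root case is BCGP 2025 §7 + Thm 277 (skeleton
stub_distinctRoots); the repeated-root case is new (stub_repeatedRootSocle). [difficulty: XL] -/
@[route_item "route-Langlands-RepeatedRootSocle"]
def LimitClassicalUnrefined : Prop :=
  ∀ (p : ℕ) [Fact p.Prime], p ≠ 2 → ∀ (k : Type) [Field k] [CharP k p] [IsAlgClosed k] [TopologicalSpace k] [DiscreteTopology k] (red : Valued.integer (PadicAlgCl p) →+* k) (hcpt : Literature.NumberTheory.Automorphic.isCompact_glFiniteIntegralLevel 4 ℚ) (ι : PadicAlgCl p ≃+* ℂ), let R4 := Literature.NumberTheory.GaloisRepresentations.FramedGaloisRep ℚ (PadicAlgCl p) 4; let Pl := IsDedekindDomain.HeightOneSpectrum (NumberField.RingOfIntegers ℚ); ∀ (ρ : R4), let Sympl := fun r : R4 => r.IsSymplecticWithMultiplierFun (fun g => algebraMap ℚ_[p] (PadicAlgCl p) ((((Literature.NumberTheory.GaloisRepresentations.GaloisRep.cyclotomicCharacter ℚ p g)⁻¹ : ℤ_[p]ˣ)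 : ℤ_[p]) : ℚ_[p])); let PSh := fun (r : R4) (v : Pl) => ∃ (g : Matrix.GeneralLinearGroup (Fin 4) (PadicAlgCl p)) (α β : Field.absoluteGaloisGroup (v.adicCompletion ℚ) →* (PadicAlgCl p)ˣ), (∀ τ ∈ Literature.NumberTheory.GaloisRepresentations.absInertia (v.adicCompletion ℚ), α τ = 1 ∧ β τ = 1) ∧ ∀ τ, (∀ i j : Fin 4, j < i → (g⁻¹ * r.toLocal v τ * g).val i j = 0) ∧ (g⁻¹ * r.toLocal v τ * g).val 0 1 = 0 ∧ (g⁻¹ * r.toLocal v τ * g).val 2 3 = 0 ∧ (g⁻¹ * r.toLocal v τ * g).val 0 0 = algebraMap ℚ_[p] (PadicAlgCl p) (((Literature.NumberTheory.GaloisRepresentations.GaloisRep.cyclotomicCharacter (v.adicCompletion ℚ) p τ : ℤ_[p]ˣ) : ℤ_[p]) : ℚ_[p]) * α τ ∧ (g⁻¹ * r.toLocal v τ * g).val 1 1 = algebraMap ℚ_[p] (PadicAlgCl p) (((Literature.NumberTheory.GaloisRepresentations.GaloisRep.cyclotomicCharacter (v.adicCompletion ℚ) p τ : ℤ_[p]ˣ)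 : ℤ_[p]) : ℚ_[p]) * β τ ∧ (g⁻¹ * r.toLocal v τ * g).val 2 2 = ((β τ)⁻¹ : (PadicAlgCl p)ˣ) ∧ (g⁻¹ * r.toLocal v τ * g).val 3 3 = ((α τ)⁻¹ : (PadicAlgCl p)ˣ); let Pure := fun r : R4 => ∀ᶠ v : Pl in Filter.cofinite, r.IsUnramifiedAt v ∧ ∃ P : Polynomial ℤ, r.HasFrobCharpolyAt v (P.map (Int.castRingHom (PadicAlgCl p))) ∧ ∀ z : ℂ, (P.map (Int.castRingHom ℂ)).IsRoot z → ‖z‖ ^ 2 = (v.residueCard : ℝ); let BigRes := fun r : R4 => ∃ σ : Literature.NumberTheory.GaloisRepresentations.FramedGaloisRep ℚ k 4, (∀ᶠ v : Pl in Filter.cofinite, ∃ (P : Polynomial (Valued.integer (PadicAlgCl p))) (Pb : Polynomial k), r.HasFrobCharpolyAt v (P.map (Valued.integer (PadicAlgCl p)).subtype) ∧ σ.HasFrobCharpolyAt v Pb ∧ P.map red = Pb) ∧ σ.toGaloisRep.IsIrreducible ∧ ∃ x, ((σ x).val.charpoly).Separable; let Aut := fun r : R4 => ∃ π : Literature.NumberTheory.Automorphic.CuspidalAutomorphicRepData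 4 ℚ hcpt, π.1.IsLAlgebraic ∧ ∀ᶠ v : Pl in Filter.cofinite, ∃ a : Multiset ℂ, π.1.HasSatakeParamAt v a ∧ r.IsUnramifiedAt v ∧ r.HasFrobCharpolyAt v (Literature.NumberTheory.Automorphic.arithFrobPolyOfSatake ι v.residueCard 1 a); let Lim := fun r : R4 => ∀ m : ℕ, ∃ r' : R4, Aut r' ∧ ∀ᶠ v : Pl in Filter.cofinite, ∃ P P' : Polynomial (Valued.integer (PadicAlgCl p)), r.HasFrobCharpolyAt v (P.map (Valued.integer (PadicAlgCl p)).subtype) ∧ r'.HasFrobCharpolyAt v (P'.map (Valued.integer (PadicAlgCl p)).subtype) ∧ ∀ i : ℕ, ((p : ℕ) : Valued.integer (PadicAlgCl p)) ^ m ∣ (P - P').coeff i; ρ.toGaloisRep.IsIrreducible → Sympl ρ → (∀ v : Pl, ((p : ℕ) : NumberField.RingOfIntegers ℚ) ∈ v.asIdeal → PSh ρ v) → Pure ρ → BigRes ρ → Lim ρ → Aut ρ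

/-- item stmt-Langlands-18088 · aside · rank 3 · open · by planner
why it might fail: at a repeated-root point 𝔮 lies on TWO crossing components and BCGP's neighbourhood R^red[1/p]=T[1/p] must hit a component specialising to ρ; their 'further local complications' are printed only up to the p-distinguished freeness step; BigRes is weaker than vast/tidy.
sources: BoxerEtAl2021, arXiv:1812.09269, BoxerCalegariGeePilloni2025, arXiv:2502.20645
[crux] p-ADIC AUTOMORPHY WITHOUT REFINEMENT. Under the target's hypotheses (ρ₀ automorphic,
congruent a.e. to ρ; both irreducible, symplectic-ε⁻¹, Siegel weight-2 ordinary at p with no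
distinctness, pure a.e.; ρ residually enormous), ρ is a p-adic limit of automorphic representations:
for every m there is an automorphic ρ_m : Γ_ℚ → GL₄(ℚ̄_p) whose Frobenius polynomials are ≡ those of
ρ modulo p^m at almost all places. Intended proof: BCGP 2021 §7 / BCGP 2025 §§6–7 Taylor–Wiles
patching of ordinary higher-Hida complexes gives R^red[1/p] = T[1/p] in a neighbourhood of the prime
𝔮 of ρ ("M_𝔮 ≠ 0", printed without distinguishedness 'in principle', p.104), so the eigensystem of ρ
is a char-0 point of the Hida family and ρ is the limit of the Galois representations of classical
regular-weight ordinary points accumulating at x. Residually distinguished case = BCGP 2021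
(stub_residuallyDistinguishedFamily); residually non-distinguished = BCGP 2025 neighbourhood
argument (stub_nonDistinguishedNeighbourhood). [difficulty: L] -/
@[route_item "route-Langlands-RepeatedRootSocle"]
def PadicLimitUnrefined : Prop :=
  ∀ (p : ℕ) [Fact p.Prime], p ≠ 2 → ∀ (k : Type) [Field k] [CharP k p] [IsAlgClosed k] [TopologicalSpace k] [DiscreteTopology k] (red : Valued.integer (PadicAlgCl p) →+* k) (hcpt : Literature.NumberTheory.Automorphic.isCompact_glFiniteIntegralLevel 4 ℚ) (ι : PadicAlgCl p ≃+* ℂ), let R4 := Literature.NumberTheory.GaloisRepresentations.FramedGaloisRep ℚ (PadicAlgCl p) 4; let Pl := IsDedekindDomain.HeightOneSpectrum (NumberField.RingOfIntegers ℚ); ∀ (ρ₀ ρ : R4), let Sympl := fun r : R4 => r.IsSymplecticWithMultiplierFun (fun g => algebraMap ℚ_[p] (PadicAlgCl p) ((((Literature.NumberTheory.GaloisRepresentations.GaloisRep.cyclotomicCharacter ℚ p g)⁻¹ : ℤ_[p]ˣ) : ℤ_[p]) : ℚ_[p])); let PSh := fun (r : R4) (v : Pl) => ∃ (g : Matrix.GeneralLinearGroup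 (Fin 4) (PadicAlgCl p)) (α β : Field.absoluteGaloisGroup (v.adicCompletion ℚ) →* (PadicAlgCl p)ˣ), (∀ τ ∈ Literature.NumberTheory.GaloisRepresentations.absInertia (v.adicCompletion ℚ), α τ = 1 ∧ β τ = 1) ∧ ∀ τ, (∀ i j : Fin 4, j < i → (g⁻¹ * r.toLocal v τ * g).val i j = 0) ∧ (g⁻¹ * r.toLocal v τ * g).val 0 1 = 0 ∧ (g⁻¹ * r.toLocal v τ * g).val 2 3 = 0 ∧ (g⁻¹ * r.toLocal v τ * g).val 0 0 = algebraMap ℚ_[p] (PadicAlgCl p) (((Literature.NumberTheory.GaloisRepresentations.GaloisRep.cyclotomicCharacter (v.adicCompletion ℚ) p τ : ℤ_[p]ˣ) : ℤ_[p]) : ℚ_[p]) * α τ ∧ (g⁻¹ * r.toLocal v τ * g).val 1 1 = algebraMap ℚ_[p] (PadicAlgCl p) (((Literature.NumberTheory.GaloisRepresentations.GaloisRep.cyclotomicCharacter (v.adicCompletion ℚ) p τ : ℤ_[p]ˣ) : ℤ_[p]) : ℚ_[p]) * β τ ∧ (g⁻¹ * r.toLocal v τ * g).val 2 2 = ((β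 τ)⁻¹ : (PadicAlgCl p)ˣ) ∧ (g⁻¹ * r.toLocal v τ * g).val 3 3 = ((α τ)⁻¹ : (PadicAlgCl p)ˣ); let Pure := fun r : R4 => ∀ᶠ v : Pl in Filter.cofinite, r.IsUnramifiedAt v ∧ ∃ P : Polynomial ℤ, r.HasFrobCharpolyAt v (P.map (Int.castRingHom (PadicAlgCl p))) ∧ ∀ z : ℂ, (P.map (Int.castRingHom ℂ)).IsRoot z → ‖z‖ ^ 2 = (v.residueCard : ℝ); let Cong := fun r r' : R4 => ∀ᶠ v : Pl in Filter.cofinite, ∃ P P' : Polynomial (Valued.integer (PadicAlgCl p)), r.HasFrobCharpolyAt v (P.map (Valued.integer (PadicAlgCl p)).subtype) ∧ r'.HasFrobCharpolyAt v (P'.map (Valued.integer (PadicAlgCl p)).subtype) ∧ P.map red = P'.map red; let BigRes := fun r : R4 => ∃ σ : Literature.NumberTheory.GaloisRepresentations.FramedGaloisRep ℚ k 4, (∀ᶠ v : Pl in Filter.cofinite, ∃ (P : Polynomial (Valued.integer (PadicAlgCl p))) (Pb : Polynomial k), r.HasFrobCharpolyAt v (P.map (Valued.integer (PadicAlgCl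 p)).subtype) ∧ σ.HasFrobCharpolyAt v Pb ∧ P.map red = Pb) ∧ σ.toGaloisRep.IsIrreducible ∧ ∃ x, ((σ x).val.charpoly).Separable; let Aut := fun r : R4 => ∃ π : Literature.NumberTheory.Automorphic.CuspidalAutomorphicRepData 4 ℚ hcpt, π.1.IsLAlgebraic ∧ ∀ᶠ v : Pl in Filter.cofinite, ∃ a : Multiset ℂ, π.1.HasSatakeParamAt v a ∧ r.IsUnramifiedAt v ∧ r.HasFrobCharpolyAt v (Literature.NumberTheory.Automorphic.arithFrobPolyOfSatake ι v.residueCard 1 a); let Lim := fun r : R4 => ∀ m : ℕ, ∃ r' : R4, Aut r' ∧ ∀ᶠ v : Pl in Filter.cofinite, ∃ P P' : Polynomial (Valued.integer (PadicAlgCl p)), r.HasFrobCharpolyAt v (P.map (Valued.integer (PadicAlgCl p)).subtype) ∧ r'.HasFrobCharpolyAt v (P'.map (Valued.integer (PadicAlgCl p)).subtype) ∧ ∀ i : ℕ, ((p : ℕ) : Valued.integer (PadicAlgCl p)) ^ m ∣ (P - P').coeff i; ρ₀.toGaloisRep.IsIrreducible → Sympl ρ₀ → (∀ v : Pl, ((p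 : ℕ) : NumberField.RingOfIntegers ℚ) ∈ v.asIdeal → PSh ρ₀ v) → Pure ρ₀ → Aut ρ₀ → ρ.toGaloisRep.IsIrreducible → Sympl ρ → (∀ v : Pl, ((p : ℕ) : NumberField.RingOfIntegers ℚ) ∈ v.asIdeal → PSh ρ v) → Pure ρ → BigRes ρ → Cong ρ₀ ρ → Lim ρ

-- item stmt-Langlands-18095 · support · rank 3 · open · by planner — informal only, no Lean statement yet:
--   [crux] SOCLE-COUSIN VANISHING (layer-2 child of LimitClassicalUnrefined; the transferred GL2
--   weight-one alpha=beta move). In the setting of FibreCyclicity with rho de Rham at p: (i) the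
--   coinvariants V / m_f V are D_Sen(rho_f)^{oplus n} as semilinear Galois modules (the coinvariant
--   variant of BCGP Lemma Galois-rep-cc announced in arXiv:2502.20645 Rem 279: Chebotarev + enormous
--   image over the Artinian fibre, a Carayol-type lemma); (ii) the Cousin map c : Mbar^(2) -> Mbar^(3)
--   induced by the nilpotent part of the arithmetic Sen operator is A-linear (Hecke-equivariance of Sen
--   and of the filtration)

/-- item stmt-Langlands-18089 · aside · rank 9 · open · by planner
why it might fail: it IS the open reciprocity conjecture outside one GSp₄/ℚ sector; `Langlands` as typed may over-claim in corners (irregular π, even ρ). Imported complement; judge the route on LimitClassicalUnrefined / PadicLimitUnrefined, never staff it from this route.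
sources: BuzzardGeeLMS2014, FontaineMazurGeometric1995, Calegari2023
[crux] COMPLEMENT OF THE SECTOR = the rest of the summit: UnrefinedWeightTwoLifting → Langlands
(every n ≠ 4, every F ≠ ℚ, direction (A), local–global compatibility at every place, the reciprocity
data 𝓡, all of (B) outside symplectic weight-2 ordinary ρ over ℚ). Not attacked by this route, never
staffed from it; filed as a crux so that `closes` has every hypothesis declared (same convention as
EisensteinGelfandKirillov.SectorComplement, PhantomRMYoshida.PhantomRMJunction). [difficulty:
open-problem] -/
@[route_item "route-Langlands-RepeatedRootSocle"]
def SectorComplement : Prop :=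
  UnrefinedWeightTwoLifting → _root_.Langlands

/-- item stmt-Langlands-18090 · assembly · rank 1 · open · by planner
sources: BoxerCalegariGeePilloni2025, BoxerEtAl2021
[assembly] PadicLimitUnrefined → LimitClassicalUnrefined → SectorComplement → Langlands (two modus
ponens through the target; identical in content to `closes`, proved in Sketch.lean). -/
@[route_item "route-Langlands-RepeatedRootSocle"]
def Assembly : Prop :=
  PadicLimitUnrefined → LimitClassicalUnrefined → SectorComplement → _root_.Langlands

/-! D-0027 §2.1 — DECIDING THEOREM (planner-authored via `route open/edit --closes-file`; by planner-rbadge-Langlands-RepeatedRootSocle-0fc61bc5-g3-0 2026-08-17T13:07:42Z):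
its hypotheses are this route's items and its conclusion the sub-problem Statement (glue_lint), and it elaborates with this file. -/

@[closes "route-Langlands-RepeatedRootSocle"] theorem closes (hP : PadicLimitUnrefinedR) (hC : LimitClassicalUnrefinedR)
    (hSC : SectorComplementR) : _root_.Langlands := by
  -- legacy frame item `Assembly` (rev ≤ 4 decls, multiplier ε⁻¹): two modus ponens, no hypothesis used
  have _hA : Assembly := by
    intro hP' hC' hSC'
    refine hSC' ?_
    intro p _ hp k _ _ _ _ _ red hcpt ι R4 Pl ρ₀ ρ Sympl PSh Pure Cong BigRes Aut
      h0irr h0sym h0sh h0pure h0aut hirr hsym hsh hpure hbig hcong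
    exact hC' p hp k red hcpt ι ρ hirr hsym hsh hpure hbig
      (hP' p hp k red hcpt ι ρ₀ ρ h0irr h0sym h0sh h0pure h0aut hirr hsym hsh hpure hbig hcong)
  -- the repaired line: PadicLimitUnrefinedR feeds the `Lim` hypothesis of LimitClassicalUnrefinedR,
  -- giving the repaired target UnrefinedWeightTwoLiftingR; SectorComplementR carries it to `Langlands`.
  refine hSC ?_
  intro p _ hp k _ _ _ _ _ red hcpt ι R4 Pl ρ₀ ρ Sympl PSh Pure Cong BigRes Aut
    h0irr h0sym h0sh h0pure h0aut hirr hsym hsh hpure hbig hcong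
  exact hC p hp k red hcpt ι ρ hirr hsym hsh hpure hbig
    (hP p hp k red hcpt ι ρ₀ ρ h0irr h0sym h0sh h0pure h0aut hirr hsym hsh hpure hbig hcong)

end Summit.Langlands.Langlands.Theses.RepeatedRootSocle
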